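import Literature.AlgebraicGeometry.HodgeTheory.GlobalInvariantCyclesSectionsProofs
import Literature.AlgebraicGeometry.HodgeTheory.MotivatedClassesDeformationInputs
import Literature.AlgebraicGeometry.HodgeTheory.IsoTransport
import HarnessLib

/-!
# Flat sections of `Rᵏ f_* ℂ` through a non-zero class vanish nowhere

Family `hodge`, layer `Literature/AlgebraicGeometry/HodgeTheory`; theorems only (no definition, no
named fact), supporting the named fact `HodgeTheory.weilFamilyReach_hyperbolic`
(`HodgeTheory/WeilFamilyReach`) and its family-first sibling
`HodgeTheory.weilFamily_hyperbolic_weilSystem_reach` (`HodgeTheory/WeilFamilyReachSystem`).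

In the proof of [Deligne1982HodgeCycles, Thm. 4.8] (LNM 900, pp. 48–51) a Weil class `t` of the
special fibre is continued along the family `Γ\B → Γ\X⁺` as a FLAT section of the local system
`⋀^{2k}_E R¹f_*ℚ ⊂ R^{2k} f_* ℚ`; the continued class is used at the other end (`s₁`) as a NON-ZERO
Weil class of that fibre. The non-vanishing is the elementary fact that parallel transport in a
local system is an isomorphism of stalks (Voisin, *Hodge Theory I*, §9.2.1: along `γ` and back along
`γ⁻¹` is the identity) and that a continuous section of the espace étalé is carried into itself by
transport (Voisin, *Hodge Theory II*, Lemma 4.17; the tree's `transportFun_clsAt_of_continuous`).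
On the tree's real carriers (`FiberClass f k` with its étalé topology, `transportFun` of
`HodgeTheory/DirectImageTransport`) this file records:

* `transportFun_zero`, `transportFun_injective`, `transportFun_eq_zero_iff`, `transportFun_ne_zero`
  — transport along a homotopy class of paths in a cohomologically locally trivial `U ⊆ S(ℂ)` is an
  injective `ℂ`-linear map (it has the inverse `transportFun γ⁻¹`);
* `FiberClass.clsAt_eq_zero_iff` — bookkeeping: a fibre class viewed in a prescribed fibre is zero
  iff its class is zero;
* `FiberClass.clsAt_ne_zero_of_continuous` — a continuous section `σ` of `FiberClass.pt` over `U`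
  which is non-zero at `s` is non-zero at every `t` joined to `s` by a path of `U`;
* `FiberClass.cls_ne_zero_of_continuous`, `FiberClass.ne_zero_of_continuous_of_eq_mk` — over a
  path-connected `S(ℂ)` on which `Rᵏ f_* ℂ` is a local system, a continuous section through a
  non-zero class vanishes NOWHERE (stated for `(σ s).cls` and for values written `σ s = ⟨s, x⟩`);
* `FiberClass.cls_ne_zero_of_isSmoothProjectiveFamily`,
  `FiberClass.ne_zero_of_isSmoothProjectiveFamily_of_eq_mk` — the same under EXACTLY the family
  clauses of the Weil-family facts: `Motives.IsSmoothProjectiveFamily f n`, `IrreducibleSpace S.left`,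
  `Smooth S.hom`, `IsQuasiProjectiveOver S` (then `S(ℂ)` is a connected — SGA1 XII 2.4, the tree's
  `Motives.ComplexPoints.connectedSpace_iff_holds` — topological manifold of the pure dimension of
  `S`, `exists_smoothOfRelativeDimension_of_connectedSpace_complexPoints`, hence path connected, and
  `Rᵏ f_* ℂ` is a local system on it by Ehresmann,
  `isCohomologicallyLocallyTrivialOn_univ_of_isSmoothProjectiveFamily`);
* `complexBetti.map_ne_zero_of_iso` — reading a non-zero fibre class in a chart `e : A ≅ 𝒳_s` keeps
  it non-zero.

This is the clause "`σ(s₁)` is a NON-ZERO class of the Weil plane of `(A', φ')`" of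
`weilFamilyReach_hyperbolic`, for any continuous section through `e'^{-1 *} w`, `w ≠ 0`; consumers of
the family-first fact `weilFamily_hyperbolic_weilSystem_reach` (which records the flat Weil sections
but not their non-vanishing) recover it from here.

## References

* [VoisinHodgeI2002] C. Voisin, Hodge Theory and Complex Algebraic Geometry I, CUP 2002, §9.2.1
  (local systems and monodromy), Thm. 9.3 (Ehresmann).
* [VoisinHodgeII2003] C. Voisin, Hodge Theory and Complex Algebraic Geometry II, CUP 2003,
  Lemma 4.17, §3.1.2.
* [Deligne1982HodgeCycles] P. Deligne (notes by J. S. Milne), Hodge cycles on abelian varieties,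
  LNM 900 (1982), proof of Thm. 4.8, pp. 48–51.
-/

noncomputable section

open CategoryTheory AlgebraicGeometry
open _root_.Topology

namespace Literature.AlgebraicGeometry.HodgeTheory

/-! ### Transport is injective -/

section Transport

variable {𝒳 S : Motives.SchemeOver ℂ} (π : 𝒳 ⟶ S) (k : ℕ) {U : Set (Motives.ComplexPoints S)}
  (hU : IsCohomologicallyLocallyTrivialOn π U)

/-- Transport of the zero class is the zero class (transport is `ℂ`-linear).
[cite: VoisinHodgeI2002, §9.2.1] -/
theorem transportFun_zero {s t : U} (γ : Path.Homotopic.Quotient s t) :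
    transportFun π k hU γ (0 : complexBetti (Motives.fiberOver π s.1) k) = 0 := by
  rw [← transportLinear_apply]
  exact map_zero _

/-- **Transport along a homotopy class of paths is injective**: transporting back along `γ⁻¹` is a
left inverse (`(γ · γ⁻¹)_* = id`). [cite: VoisinHodgeI2002, §9.2.1] -/
theorem transportFun_injective {s t : U} (γ : Path.Homotopic.Quotient s t) :
    Function.Injective (transportFun π k hU γ) := by
  intro α β h
  have h' := congrArg (transportFun π k hU γ.symm) h
  rwa [← transportFun_trans, ← transportFun_trans, Path.Homotopic.Quotient.trans_symm,
    transportFun_refl, transportFun_refl] at h'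

/-- A transported class vanishes iff the class vanishes. [cite: VoisinHodgeI2002, §9.2.1] -/
theorem transportFun_eq_zero_iff {s t : U} (γ : Path.Homotopic.Quotient s t)
    (α : complexBetti (Motives.fiberOver π s.1) k) :
    transportFun π k hU γ α = 0 ↔ α = 0 := by
  refine ⟨fun h ↦ transportFun_injective π k hU γ ?_, fun h ↦ h ▸ transportFun_zero π k hU γ⟩
  rw [h, transportFun_zero]

/-- **Transport of a non-zero class is non-zero.** [cite: VoisinHodgeI2002, §9.2.1] -/
theorem transportFun_ne_zero {s t : U} (γ : Path.Homotopic.Quotient s t)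
    {α : complexBetti (Motives.fiberOver π s.1) k} (hα : α ≠ 0) :
    transportFun π k hU γ α ≠ 0 :=
  fun h ↦ hα ((transportFun_eq_zero_iff π k hU γ α).1 h)

end Transport

/-! ### Continuous sections through a non-zero class -/

section Sections

variable {𝒳 S : Motives.SchemeOver ℂ} (π : 𝒳 ⟶ S) (k : ℕ) {U : Set (Motives.ComplexPoints S)}

variable {π k} in
/-- A fibre class viewed in a prescribed fibre is zero iff its class is zero. [folklore] -/
theorem FiberClass.clsAt_eq_zero_iff (x : FiberClass π k) {t : Motives.ComplexPoints S}
    (h : x.pt = t) : x.clsAt h = 0 ↔ x.cls = 0 := by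
  subst h
  exact Iff.rfl

/-- **A continuous section non-zero at `s` is non-zero at every `t` joined to `s` by a path of
`U`**: its value at `t` is the transport of its value at `s` (continuous sections are flat,
`transportFun_clsAt_of_continuous`), and transport is injective.
[cite: VoisinHodgeII2003, Lemma 4.17] [cite: VoisinHodgeI2002, §9.2.1] -/
theorem FiberClass.clsAt_ne_zero_of_continuous (hU : IsCohomologicallyLocallyTrivialOn π U)
    {σ : Motives.ComplexPoints S → FiberClass π k} (hσ : Continuous σ) (hpt : ∀ s, (σ s).pt = s)
    {s t : U} (γ : Path s t) (hs : (σ s.1).clsAt (hpt s.1) ≠ 0) :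
    (σ t.1).clsAt (hpt t.1) ≠ 0 := by
  rw [← transportFun_clsAt_of_continuous π k hU hσ hpt γ]
  exact transportFun_ne_zero π k hU _ hs

/-- **Over a path-connected base on which `Rᵏ π_* ℂ` is a local system, a continuous section
through a non-zero class vanishes nowhere.** [cite: VoisinHodgeII2003, Lemma 4.17]
[cite: VoisinHodgeI2002, §9.2.1] -/
theorem FiberClass.cls_ne_zero_of_continuous [PathConnectedSpace (Motives.ComplexPoints S)]
    (hU : IsCohomologicallyLocallyTrivialOn π (Set.univ : Set (Motives.ComplexPoints S)))
    {σ : Motives.ComplexPoints S → FiberClass π k} (hσ : Continuous σ) (hpt : ∀ s, (σ s).pt = s)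
    {s₀ : Motives.ComplexPoints S} (h₀ : (σ s₀).cls ≠ 0) (s : Motives.ComplexPoints S) :
    (σ s).cls ≠ 0 := by
  let γ : Path (⟨s₀, Set.mem_univ s₀⟩ : (Set.univ : Set (Motives.ComplexPoints S)))
      ⟨s, Set.mem_univ s⟩ :=
    (PathConnectedSpace.somePath s₀ s).map (continuous_id.subtype_mk _)
  have h₀' : (σ s₀).clsAt (hpt s₀) ≠ 0 := by rwa [Ne, FiberClass.clsAt_eq_zero_iff]
  have h := FiberClass.clsAt_ne_zero_of_continuous π k hU hσ hpt γ h₀'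
  rwa [Ne, FiberClass.clsAt_eq_zero_iff] at h

/-- The same for values written `σ s = ⟨s, x⟩` (the shape in which the Weil-family facts record the
values of their flat sections): if `σ s₀ = ⟨s₀, α⟩` with `α ≠ 0` and `σ s = ⟨s, β⟩`, then `β ≠ 0`.
[cite: VoisinHodgeII2003, Lemma 4.17] [cite: VoisinHodgeI2002, §9.2.1] -/
theorem FiberClass.ne_zero_of_continuous_of_eq_mk [PathConnectedSpace (Motives.ComplexPoints S)]
    (hU : IsCohomologicallyLocallyTrivialOn π (Set.univ : Set (Motives.ComplexPoints S)))
    {σ : Motives.ComplexPoints S → FiberClass π k} (hσ : Continuous σ) (hpt : ∀ s, (σ s).pt = s)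
    {s₀ : Motives.ComplexPoints S} {α : complexBetti (Motives.fiberOver π s₀) k}
    (h₀ : σ s₀ = ⟨s₀, α⟩) (hα : α ≠ 0) {s : Motives.ComplexPoints S}
    {β : complexBetti (Motives.fiberOver π s) k} (hs : σ s = ⟨s, β⟩) : β ≠ 0 := by
  have h₀' : (σ s₀).cls ≠ 0 := by rw [h₀]; exact hα
  have h := FiberClass.cls_ne_zero_of_continuous π k hU hσ hpt h₀' s
  rw [hs] at h
  exact h

end Sections

/-! ### Under the family clauses of the Weil-family facts -/

section Families

variable {𝒳 S : Motives.SchemeOver ℂ} (f : 𝒳 ⟶ S) {n : ℕ} (k : ℕ)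

/-- **Flat sections of `Rᵏ f_* ℂ` through a non-zero class vanish nowhere, for a smooth projective
family over a smooth irreducible quasi-projective base** — the hypotheses being exactly the family
clauses of `weilFamilyReach_hyperbolic` / `weilFamily_hyperbolic_weilSystem_reach` /
`deligne1982_weilFamily_globalAction`. Then `S(ℂ)` is connected (SGA1 XII Prop. 2.4, the tree's
`Motives.ComplexPoints.connectedSpace_iff_holds`), a topological manifold of the pure dimension of
`S` (`exists_smoothOfRelativeDimension_of_connectedSpace_complexPoints`), hence path connected, and
`Rᵏ f_* ℂ` is a local system on it (Ehresmann; Voisin I, Thm. 9.3 and §9.2.1; the tree's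
`isCohomologicallyLocallyTrivialOn_univ_of_isSmoothProjectiveFamily`), so
`FiberClass.cls_ne_zero_of_continuous` applies. [cite: VoisinHodgeI2002, Thm. 9.3 and §9.2.1]
[cite: VoisinHodgeII2003, Lemma 4.17] [cite: Deligne1982HodgeCycles, proof of Thm. 4.8 (pp. 48–51)] -/
theorem FiberClass.cls_ne_zero_of_isSmoothProjectiveFamily
    (hfam : Motives.IsSmoothProjectiveFamily f n) (hirr : IrreducibleSpace S.left)
    (hsm : Smooth S.hom) (hSqp : IsQuasiProjectiveOver S)
    {σ : Motives.ComplexPoints S → FiberClass f k} (hσ : Continuous σ) (hpt : ∀ s, (σ s).pt = s)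
    {s₀ : Motives.ComplexPoints S} (h₀ : (σ s₀).cls ≠ 0) (s : Motives.ComplexPoints S) :
    (σ s).cls ≠ 0 := by
  haveI := hsm
  haveI := hirr
  haveI : LocallyOfFiniteType S.hom := hSqp.locallyOfFiniteType
  haveI : ConnectedSpace (Motives.ComplexPoints S) :=
    (Motives.ComplexPoints.connectedSpace_iff_holds S).2 inferInstance
  obtain ⟨d, hd⟩ := exists_smoothOfRelativeDimension_of_connectedSpace_complexPoints S
  haveI := hd
  haveI := pathConnectedSpace_complexPoints_of_smoothOfRelativeDimension S d
  exact FiberClass.cls_ne_zero_of_continuous f k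
    (isCohomologicallyLocallyTrivialOn_univ_of_isSmoothProjectiveFamily f d hfam hSqp) hσ hpt h₀ s

/-- The same for values written `σ s = ⟨s, x⟩`: under the family clauses, if `σ s₀ = ⟨s₀, α⟩` with
`α ≠ 0` and `σ s = ⟨s, β⟩`, then `β ≠ 0`. [cite: VoisinHodgeI2002, Thm. 9.3 and §9.2.1]
[cite: VoisinHodgeII2003, Lemma 4.17] [cite: Deligne1982HodgeCycles, proof of Thm. 4.8 (pp. 48–51)] -/
theorem FiberClass.ne_zero_of_isSmoothProjectiveFamily_of_eq_mk
    (hfam : Motives.IsSmoothProjectiveFamily f n) (hirr : IrreducibleSpace S.left)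
    (hsm : Smooth S.hom) (hSqp : IsQuasiProjectiveOver S)
    {σ : Motives.ComplexPoints S → FiberClass f k} (hσ : Continuous σ) (hpt : ∀ s, (σ s).pt = s)
    {s₀ : Motives.ComplexPoints S} {α : complexBetti (Motives.fiberOver f s₀) k}
    (h₀ : σ s₀ = ⟨s₀, α⟩) (hα : α ≠ 0) {s : Motives.ComplexPoints S}
    {β : complexBetti (Motives.fiberOver f s) k} (hs : σ s = ⟨s, β⟩) : β ≠ 0 := by
  have h₀' : (σ s₀).cls ≠ 0 := by rw [h₀]; exact hα
  have h := FiberClass.cls_ne_zero_of_isSmoothProjectiveFamily f k hfam hirr hsm hSqp hσ hpt h₀' s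
  rw [hs] at h
  exact h

end Families

/-! ### Reading a non-zero class in a chart -/

section Charts

variable {X X' : Motives.SchemeOver ℂ}

/-- Pull-back along an isomorphism of `ℂ`-schemes takes non-zero classes to non-zero classes
(`e^*` is bijective, `complexBetti.bijective_map_of_iso`). [folklore] -/
theorem complexBetti.map_ne_zero_of_iso (e : X' ≅ X) (i : ℕ) {c : complexBetti X i} (hc : c ≠ 0) :
    complexBetti.map e.hom i c ≠ 0 := by
  intro h
  apply hc
  apply (complexBetti.bijective_map_of_iso e i).1
  rw [h]
  exact (map_zero _).symm

/-- Along an isomorphism a class is non-zero iff its pull-back is. [folklore] -/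
theorem complexBetti.map_ne_zero_iff_of_iso (e : X' ≅ X) (i : ℕ) (c : complexBetti X i) :
    complexBetti.map e.hom i c ≠ 0 ↔ c ≠ 0 :=
  ⟨fun h hc ↦ h (by rw [hc]; exact map_zero _), complexBetti.map_ne_zero_of_iso e i⟩

end Charts

end Literature.AlgebraicGeometry.HodgeTheory

end
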